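import Mathlib.AlgebraicTopology.FundamentalGroupoid.SimplyConnected
import Mathlib.Topology.ContinuousMap.Basic
import Mathlib.Topology.Order.Compact
import HarnessLib

/-!
# The top level of a slab is simply connected when the punctured sublevel set is

Topic `Literature/AlgebraicTopology/FundamentalGroupoid`. An elementary compactness lemma used
to read the fundamental group of a regular level `f⁻¹(ε)` of a proper function from that of the
punctured sublevel set `{0 < f ≤ ε}` (J. Milnor, *Morse theory* (1963), §3, Thm. 3.1: if `f` has
no critical values in `[δ, ε]` then `f⁻¹[δ, ε] ≅ f⁻¹(ε) × [δ, ε]`, in particular `f⁻¹(ε)` is a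
retract of `f⁻¹[δ, ε]`; A. Kosinski, *Differential Manifolds* (1993), VI.(11.5): the boundary of
a handlebody is highly connected). If every slab `{δ ≤ f ≤ ε}`, `0 < δ < ε`, retracts onto the
level `{f = ε}`, then a loop in the level which is null-homotopic in `{0 < f ≤ ε}` is
null-homotopic in the level: the null-homotopy has compact image, on which `f` is bounded below
by some `δ > 0`, and is pushed into the level by the retraction of that slab (as in Hatcher,
*Algebraic Topology* (2002), Prop. 1.17):

* `Literature.AlgebraicTopology.FundamentalGroupoid.isSimplyConnected_level_of_slab_retractions`.

For the `E₈` plumbing `M(4m) = {ρ ≤ ε}` cut out of the open plumbing by a size function `ρ ≥ 0`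
vanishing exactly on the core spheres (Kosinski VI.12), this reduces `π₁(∂M(4m)) = 1` to the
simple connectivity of `{0 < ρ ≤ ε} = M(4m) ∖ (cores)` (general position, codimension `2m ≥ 3`)
and Milnor's product structure on the slabs. Everything is proved; no definitions.

## References

* J. Milnor, *Morse theory*, Ann. of Math. Studies 51 (1963), §3 Thm. 3.1. [Milnor1963]
* A. Hatcher, *Algebraic Topology*, CUP 2002, Prop. 1.17. [HatcherAT2002]
* A. Kosinski, *Differential Manifolds* (1993), VI.(11.5), VI.12. [Kosinski1993]
-/

noncomputable section

open Set Topology unitInterval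

namespace Literature.AlgebraicTopology.FundamentalGroupoid

variable {X : Type*} [TopologicalSpace X]

/-- On a nonempty compact set inside `{0 < f ≤ ε}` the function `f` is bounded below by some
`δ ∈ (0, ε)`, i.e. the set lies in the slab `{δ ≤ f ≤ ε}`. [folklore] -/
theorem exists_slab_of_isCompact (f : C(X, ℝ)) {ε : ℝ} {K : Set X} (hK : IsCompact K)
    (hKS : K ⊆ {x | 0 < f x ∧ f x ≤ ε}) (hne : K.Nonempty) :
    ∃ δ : ℝ, 0 < δ ∧ δ < ε ∧ K ⊆ {x | δ ≤ f x ∧ f x ≤ ε} := by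
  obtain ⟨x₀, hx₀, hmin⟩ := hK.exists_isMinOn hne f.continuous.continuousOn
  have h0 : 0 < f x₀ := (hKS hx₀).1
  have hε : f x₀ ≤ ε := (hKS hx₀).2
  refine ⟨f x₀ / 2, by linarith, by linarith, fun x hx => ⟨?_, (hKS hx).2⟩⟩
  have := hmin hx
  simp only [mem_setOf_eq] at this
  linarith

/-- **The top level of a slab is simply connected when the punctured sublevel set is.** Let
`f : X → ℝ` be continuous and `ε > 0`. If `{0 < f ≤ ε}` is simply connected and every slab
`{δ ≤ f ≤ ε}` (`0 < δ < ε`) retracts onto the level `{f = ε}` (a map continuous on the slab, into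
the level, fixing the level), then the level `{f = ε}` is simply connected (Milnor 1963, Thm. 3.1
supplies the retractions for a proper smooth `f` without critical values in `(0, ε]`).
[cite: Milnor1963, §3 Thm. 3.1] [cite: HatcherAT2002, Prop. 1.17] -/
theorem isSimplyConnected_level_of_slab_retractions (f : C(X, ℝ)) {ε : ℝ}
    (hS : IsSimplyConnected {x | 0 < f x ∧ f x ≤ ε})
    (hret : ∀ δ : ℝ, 0 < δ → δ < ε →
      ∃ r : X → X, ContinuousOn r {x | δ ≤ f x ∧ f x ≤ ε} ∧
        MapsTo r {x | δ ≤ f x ∧ f x ≤ ε} {x | f x = ε} ∧ ∀ x, f x = ε → r x = x) :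
    IsSimplyConnected {x | f x = ε} := by
  rw [isSimplyConnected_iff_exists_homotopy_refl_forall_mem] at hS ⊢
  obtain ⟨hSpc, hSloop⟩ := hS
  -- the level lies in the punctured sublevel set (in particular `0 < ε`)
  obtain ⟨x₁, hx₁⟩ := hSpc.nonempty
  have hε : 0 < ε := hx₁.1.trans_le hx₁.2
  have hLS : {x | f x = ε} ⊆ {x | 0 < f x ∧ f x ≤ ε} := fun x (hx : f x = ε) =>
    ⟨by rw [hx]; exact hε, le_of_eq hx⟩
  refine ⟨?_, fun x p hp => ?_⟩
  · -- path connected: nonempty, and paths in `S` are pushed into the level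
    have hne : ({x | f x = ε} : Set X).Nonempty := by
      obtain ⟨δ, hδ0, hδε, hK⟩ := exists_slab_of_isCompact f isCompact_singleton
        (singleton_subset_iff.2 hx₁) (singleton_nonempty x₁)
      obtain ⟨r, -, hrT, -⟩ := hret δ hδ0 hδε
      exact ⟨r x₁, hrT (hK (mem_singleton x₁))⟩
    refine ⟨hne.some, hne.some_mem, fun y hy => ?_⟩
    have hx : hne.some ∈ {x | f x = ε} := hne.some_mem
    obtain ⟨γ, hγ⟩ := hSpc.joinedIn _ (hLS hx) y (hLS hy)
    obtain ⟨δ, hδ0, hδε, hK⟩ := exists_slab_of_isCompact f (isCompact_range γ.continuous)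
      (by rintro _ ⟨t, rfl⟩; exact hγ t) (range_nonempty γ)
    obtain ⟨r, hr, hrT, hid⟩ := hret δ hδ0 hδε
    have hcont : Continuous fun t : I => r (γ t) :=
      hr.comp_continuous γ.continuous fun t => hK ⟨t, rfl⟩
    refine ⟨⟨⟨fun t => r (γ t), hcont⟩, ?_, ?_⟩, fun t => hrT (hK ⟨t, rfl⟩)⟩
    · show r (γ 0) = hne.some
      rw [γ.source]; exact hid _ hx
    · show r (γ 1) = y
      rw [γ.target]; exact hid _ hy
  · -- loops: a null-homotopy in `S` has compact image, hence lies in a slab, and is retracted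
    obtain ⟨F, hF⟩ := hSloop x p fun t => hLS (hp t)
    have hx : x ∈ {x | f x = ε} := by simpa using hp 0
    obtain ⟨δ, hδ0, hδε, hK⟩ := exists_slab_of_isCompact f
      (isCompact_range F.continuous) (by rintro _ ⟨q, rfl⟩; exact hF q) (range_nonempty F)
    obtain ⟨r, hr, hrT, hid⟩ := hret δ hδ0 hδε
    have hcont : Continuous fun q : I × I => r (F q) :=
      hr.comp_continuous F.continuous fun q => hK ⟨q, rfl⟩
    refine ⟨{ toFun := fun q => r (F q)
              continuous_toFun := hcont
              map_zero_left := fun t => ?_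
              map_one_left := fun t => ?_
              prop' := fun s t ht => ?_ }, fun q => hrT (hK ⟨q, rfl⟩)⟩
    · show r (F (0, t)) = p t
      rw [F.apply_zero]; exact hid _ (hp t)
    · show r (F (1, t)) = (Path.refl x) t
      rw [F.apply_one]; exact hid _ hx
    · show r (F (s, t)) = p t
      have h := F.prop' s t ht
      simp only [ContinuousMap.coe_mk] at h ⊢
      change F (s, t) = p t at h
      rw [h]; exact hid _ (hp t)

end Literature.AlgebraicTopology.FundamentalGroupoid
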